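import Literature.Computability.AlgebraicComplexity.CircuitCodeExtFieldEvaluator
import Literature.Computability.AlgebraicComplexity.PITLanguageCompression
import HarnessLib

/-!
# Identity testing of integer arithmetic circuits MODULO A PRIME is in `coRP`
# (ACIT over `𝔽_p` as a polynomial identity; Schwartz 1980 / Agrawal–Biswas 2003 / Kabanets–Impagliazzo 2004)

Trunk AC. The language `PITLanguageMod p` of the code words `⟨bin n, ⟨C⟩⟩` of pairs `⟨n, C⟩`, `C` a
division-free arithmetic circuit over `ℤ` in `n` variables, whose polynomial VANISHES AFTER REDUCTION
MODULO `p`: `map (ℤ → ℤ/p) C.eval = 0` — for a prime `p` this is identity testing over the prime field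
`𝔽_p` as a POLYNOMIAL identity (not as a function `𝔽_p^n → 𝔽_p`), the question an algebraic natural-proof
verifier over a field of characteristic `p` must decide (Bläser–Ikenmeyer–Jindal–Lysikov 2018, proof of
Thm. 4: "`p(g) = 0`, which can be done in polynomial time by polynomial identity testing" — over an
infinite field of characteristic `p` the identity `p ∘ g = 0` of a constant-free circuit is an identity
over `𝔽_p`). For `p = 0` the language is the integer identity-testing language `PITLanguage`
(`PITLanguageMod_zero`), in `coRP` by `PITLanguageCoRP.lean`.

**Main results** (all proved, no named fact):

* **`semPolyModZero_mem_coRP`**: `{w | map (ℤ → 𝔽_p) (CircuitCode.semPoly w) = 0} ∈ coRP` for every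
  prime `p` — the zero set of the junk-tolerant circuit-code semantics reduced mod `p`, by the randomised
  extension-field zero test (`ExtFieldZeroTest.mem_coRP_of_extFieldZeroTest`,
  `Complexity/RandomizedExtensionFieldZeroTest.lean`: random monic modulus `f` of degree `k = 2|w|² + 8`,
  random `{0,1}`-point, Schwartz–Zippel in `𝔽_p[X]/(f)`) run by the `FP` evaluator
  `CircuitCode.ExtEval.exists_extEvalF` (`CircuitCodeExtFieldEvaluator.lean`), with the degree bound
  `totalDegree_semPoly_le` (`deg ≤ 2^{|w|²}`);
* **`PITLanguageMod_mem_coRP`**, `PITLanguageMod_mem_BPP` (`p` prime): the language of ALL instance codes,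
  by the Karp reduction `PITLanguageMod_karpReducible_semPolyModZero` — the two writers `pitDecode`,
  `pitCompress` of `PITLanguageCoRP.lean` and the decoder-presented reduction
  `karpReducible_of_decoder_of_codeFP` of `PITLanguageCompression.lean`, whose target-side lemma
  `map_semPoly_circuitWord_compress_eq_zero_iff` is the mod-`p` form of
  `semPoly_circuitWord_compress_eq_zero_iff` (a renaming injective on the variables preserves vanishing,
  here over any commutative semiring: `rename_eq_zero_iff_of_injOn_vars'`);
* `PITLanguageMod_zero : PITLanguageMod 0 = PITLanguage` and **`PITLanguageMod_ringChar_mem_BPP`**: for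
  every field `K`, `PITLanguageMod (ringChar K) ∈ BPP`, with the bridge
  **`map_intCast_eq_zero_iff_ringChar`**: `map (ℤ → K) P = 0 ↔ map (ℤ → ℤ/(ringChar K)) P = 0` — so a
  verifier over ANY field `K` tests "the constant-free circuit `C` computes `0` over `K`" by ONE query
  `⟨n, C⟩ ∈ PITLanguageMod (ringChar K)` to a `BPP` language (the interface of the `∃BPP` machine of
  BIJL18 Thm. 4 in every characteristic).

HONEST FRAMING: textbook randomised identity testing for the tree's concrete circuit encoding;
`VP ≠ VNP` is NOT proved and nothing here bears on it; BIJL18 Thm. 4 is a conditional barrier about the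
varieties `{borderCR ≤ r}`, not about `VP`.

## References

* J. T. Schwartz, *Fast probabilistic algorithms for verification of polynomial identities*, J. ACM 27
  (1980) 701–717, Lemma 1 / Cor. 1 (any field, any finite sample set) and §3 [Schwartz1980].
* M. Agrawal, S. Biswas, *Primality and identity testing via Chinese remaindering*, J. ACM 50 (2003),
  §1 (identity testing over finite fields modulo random low-degree polynomials) [AgrawalBiswas2003].
* V. Kabanets, R. Impagliazzo, *Derandomizing polynomial identity tests means proving circuit lower
  bounds*, Comput. Complexity 13 (2004) 1–46, §2 (arithmetic circuits as strings) and §2.3 (ACIT), Lemma 2.2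
  [KabanetsImpagliazzo2004].
* M. Bläser, C. Ikenmeyer, G. Jindal, V. Lysikov, *Generalized matrix completion and algebraic natural
  proofs*, STOC 2018, proof of Thm. 4 (ECCC TR18-064 pp. 11–12) [BlaserIkenmeyerJindalLysikov2018].
* S. Arora, B. Barak, *Computational Complexity: A Modern Approach*, CUP 2009, §7.3 (`coRP ⊆ BPP`), §7.6
  (closure under Karp reductions), Lemma 7.5, §A.4 (prime fields) [AroraBarakCC2009].
-/

noncomputable section

namespace Literature.Computability.AlgebraicComplexity

open _root_.Computability MvPolynomial
open Literature.Computability.Complexity Literature.Computability.Complexity.CodeFP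
open scoped Literature.Computability.Complexity.Notation
open Literature.Computability.Complexity.ExtFieldZeroTest
open ArithCircuit CircuitCode KIReduction PITCodeFP

/-! ### The zero set of the circuit-code semantics modulo `p` is in `coRP` -/

section SemPoly

variable (p : ℕ) [hp : Fact p.Prime]

/-- Base change does not increase the total degree (plumbing). [folklore] -/
private theorem totalDegree_map_le {R S σ : Type*} [CommSemiring R] [CommSemiring S]
    (f : R →+* S) (q : MvPolynomial σ R) : (MvPolynomial.map f q).totalDegree ≤ q.totalDegree :=
  Finset.sup_mono (MvPolynomial.support_map_subset f q)

/-- **`{w | semPoly w ≡ 0 (mod p)} ∈ coRP`**: the zero set of the junk-tolerant integer-circuit-code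
semantics REDUCED MODULO THE PRIME `p` is in `coRP`, by the randomised extension-field zero test (random
monic modulus of degree `2|w|² + 8`, random `{0,1}`-coordinate point, Schwartz–Zippel in `𝔽_p[X]/(f)`)
run by the `FP` evaluator of `CircuitCodeExtFieldEvaluator.lean`, with `deg (semPoly w) ≤ 2^{|w|²}`.
[cite: Schwartz1980, Cor. 1 and §3] [cite: AgrawalBiswas2003, §1] [cite: KabanetsImpagliazzo2004, §2.3] -/
theorem semPolyModZero_mem_coRP :
    ({w | MvPolynomial.map (Int.castRingHom (ZMod p)) (semPoly w) = 0} : Language Bool) ∈ coRP := by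
  obtain ⟨E, hE, hbit, hspec⟩ := ExtEval.exists_extEvalF p Polynomial.X (Polynomial.X ^ 2)
  exact mem_coRP_of_extFieldZeroTest (p := p) (v := Polynomial.X) (d := Polynomial.X ^ 2)
    (fun w => MvPolynomial.map (Int.castRingHom (ZMod p)) (semPoly w))
    (fun w => (totalDegree_map_le _ _).trans (totalDegree_semPoly_le w)) hE hbit
    (fun w y _ => hspec w y)

/-- **… and in `BPP`.** [cite: AroraBarakCC2009, §7.3] -/
theorem semPolyModZero_mem_BPP :
    ({w | MvPolynomial.map (Int.castRingHom (ZMod p)) (semPoly w) = 0} : Language Bool) ∈ BPP :=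
  ofLanguage_mem_PromiseBPP'_iff.1 (PromiseCoRP'_subset_PromiseBPP'
    (ofLanguage_mem_PromiseCoRP'_iff.2 (semPolyModZero_mem_coRP p)))

end SemPoly

/-! ### The language of instance codes modulo `p` -/

section Language

variable (p : ℕ)

/-- **`PIT mod p`**: the code words `boolPair (bin n) (encodeArithCircuit n C)` of pairs `⟨n, C⟩`,
`C : ArithCircuit ℤ (Fin n)`, whose polynomial vanishes after reduction modulo `p`,
`map (ℤ → ℤ/p) C.eval = 0` — identity testing of integer (in particular constant-free) circuits over the
prime field `𝔽_p` as a POLYNOMIAL identity; `p = 0` is integer identity testing (`PITLanguageMod_zero`).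
[cite: KabanetsImpagliazzo2004, §1 and §2.3 (problem ACIT over a field)] [cite: BlaserIkenmeyerJindalLysikov2018, §3 (proof of Thm. 4: "`p(g) = 0` … by polynomial identity testing")] -/
def PITLanguageMod : Language Bool :=
  {w | ∃ (n : ℕ) (C : ArithCircuit ℤ (Fin n)),
    boolPair (encodeNat n) (encodeArithCircuit n C) = w ∧ MvPolynomial.map (Int.castRingHom (ZMod p)) C.eval = 0}

/-- `PITLanguageMod p` is the language of `{⟨n, C⟩ | map C.eval = 0}` under `pitInstanceEncoding`.
[cite: KabanetsImpagliazzo2004, §2] -/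
theorem PITLanguageMod_eq_toLanguage :
    PITLanguageMod p = pitInstanceEncoding.toLanguage
      {q | MvPolynomial.map (Int.castRingHom (ZMod p)) q.2.eval = 0} := by
  ext w
  simp only [PITLanguageMod, Encoding.toLanguage]
  constructor
  · rintro ⟨n, C, rfl, hC⟩
    exact ⟨⟨n, C⟩, hC, rfl⟩
  · rintro ⟨⟨n, C⟩, hC, rfl⟩
    exact ⟨n, C, rfl, hC⟩

/-- Membership of a code word is vanishing modulo `p` of the computed polynomial.
[cite: KabanetsImpagliazzo2004, §2] -/
theorem mem_PITLanguageMod_iff (n : ℕ) (C : ArithCircuit ℤ (Fin n)) :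
    boolPair (encodeNat n) (encodeArithCircuit n C) ∈ PITLanguageMod p ↔
      MvPolynomial.map (Int.castRingHom (ZMod p)) C.eval = 0 := by
  rw [PITLanguageMod_eq_toLanguage]
  exact pitInstanceEncoding.mem_toLanguage_iff {q | MvPolynomial.map (Int.castRingHom (ZMod p)) q.2.eval = 0} ⟨n, C⟩

/-- The same on the circuit words `circuitWord m C` of `KIReductionCodes.lean` (the socket of the
all-characteristic closer of BIJL18 Thm. 4). [cite: KabanetsImpagliazzo2004, §2] -/
theorem circuitWord_mem_PITLanguageMod_iff (m : ℕ) (C : ArithCircuit ℤ (Fin m)) :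
    circuitWord m C ∈ PITLanguageMod p ↔ MvPolynomial.map (Int.castRingHom (ZMod p)) C.eval = 0 :=
  mem_PITLanguageMod_iff p m C

/-- Reduction modulo `0` is injective: `map (ℤ → ℤ/0) P = 0 ↔ P = 0`. [folklore] -/
private theorem map_zmod_zero_eq_zero_iff {σ : Type*} (P : MvPolynomial σ ℤ) :
    MvPolynomial.map (Int.castRingHom (ZMod 0)) P = 0 ↔ P = 0 := by
  have hinj : Function.Injective (Int.castRingHom (ZMod 0)) := by
    intro a b hab
    rw [eq_intCast, eq_intCast, ZMod.intCast_eq_intCast_iff_dvd_sub, Nat.cast_zero, zero_dvd_iff,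
      sub_eq_zero] at hab
    exact hab.symm
  constructor
  · intro h; exact MvPolynomial.map_injective _ hinj (by rw [h, map_zero])
  · intro h; rw [h, map_zero]

/-- **Modulo `0` nothing is reduced**: `PITLanguageMod 0 = PITLanguage`. [cite: KabanetsImpagliazzo2004, §1] -/
theorem PITLanguageMod_zero : PITLanguageMod 0 = PITLanguage := by
  ext w
  simp only [PITLanguageMod, PITLanguage, map_zmod_zero_eq_zero_iff]

end Language

/-! ### The Karp reduction to the zero set of the code semantics, modulo `p` -/

section Reduction

variable (p : ℕ)

/-- A renaming injective on the variables of `P` sends `P` to `0` only if `P = 0` (any commutative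
semiring of coefficients; the integer case is `rename_eq_zero_iff_of_injOn_vars`). [cite: AroraBarakCC2009, §7.2.3] -/
theorem rename_eq_zero_iff_of_injOn_vars' {R σ τ : Type*} [CommSemiring R] {P : MvPolynomial σ R}
    {f : σ → τ} (hf : Set.InjOn f ↑P.vars) : rename f P = 0 ↔ P = 0 := by
  classical
  refine ⟨fun h => ?_, fun h => by rw [h, map_zero]⟩
  obtain ⟨P₀, hP₀⟩ : ∃ P₀ : MvPolynomial {i // i ∈ P.vars} R, rename Subtype.val P₀ = P :=
    exists_rename_eq_of_vars_subset_range P Subtype.val Subtype.val_injective (by simp)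
  have hinj : Function.Injective (f ∘ (Subtype.val : {i // i ∈ P.vars} → σ)) :=
    fun a b hab => Subtype.ext (hf a.2 b.2 hab)
  rw [← hP₀, rename_rename] at h
  have h0 : P₀ = 0 := rename_injective _ hinj (by rw [h, map_zero])
  rw [← hP₀, h0, map_zero]

/-- **Compression preserves vanishing modulo `p`**: on the compressed code word of `⟨n, C⟩` the reduced
semantics vanishes iff `map (ℤ → ℤ/p) C.eval = 0` (the renamings `slotIdx` and `Fin.castLE` are injective on
the variables; mod-`p` form of `semPoly_circuitWord_compress_eq_zero_iff`).
[cite: KabanetsImpagliazzo2004, §2 and Lemma 2.2] [cite: Schwartz1980, §3] -/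
theorem map_semPoly_circuitWord_compress_eq_zero_iff {n : ℕ} (C : ArithCircuit ℤ (Fin n)) :
    MvPolynomial.map (Int.castRingHom (ZMod p)) (semPoly (circuitWord C.operands.length C.compress)) = 0 ↔
      MvPolynomial.map (Int.castRingHom (ZMod p)) C.eval = 0 := by
  have h := width_le_length_circuitWord_compress C
  have h' : C.operands.length ≤ Polynomial.X.eval (circuitWord C.operands.length C.compress).length := by
    rwa [Polynomial.eval_X]
  have hc : (C.compress).eval = rename C.slotIdx C.eval := by
    unfold ArithCircuit.compress; exact eval_rename_apply _ _
  rw [semPoly, rdCircuit_circuitWord h', eval_rename_apply, hc, MvPolynomial.map_rename, MvPolynomial.map_rename,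
    (MvPolynomial.rename_injective _ (Fin.castLE_injective h')).eq_iff' (map_zero _)]
  refine rename_eq_zero_iff_of_injOn_vars' ((C.slotIdx_injOn).mono ?_)
  exact (Finset.coe_subset.2 (MvPolynomial.vars_map _ _)).trans (by exact_mod_cast C.vars_eval_subset)

/-- **`PITLanguageMod p ≤ₚ {w | semPoly w ≡ 0 (mod p)}`** (any `p` with `1 ≢ 0`, in particular primes): on
code words `w ↦ circuitWord |operands| (compress C)`, `badWord` elsewhere — the two writers `pitDecode`,
`pitCompress` of `PITLanguageCoRP.lean` in the decoder-presented Karp reduction of `PITLanguageCompression.lean`.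
[cite: KabanetsImpagliazzo2004, §2 and Lemma 2.2] [cite: AroraBarakCC2009, §2.1 (Def. 2.7)] -/
theorem PITLanguageMod_karpReducible_semPolyModZero [NeZero p] (h1 : (1 : ZMod p) ≠ 0) :
    PITLanguageMod p ≤ₚ ({w | MvPolynomial.map (Int.castRingHom (ZMod p)) (semPoly w) = 0} : Language Bool) := by
  rw [PITLanguageMod_eq_toLanguage]
  refine karpReducible_of_decoder_of_codeFP pitInstanceEncoding pitDecode_encode pitDecode_codeFP
    (out := fun q => pitInstanceEncoding.encode (pitCompress q)) (pitCompress_codeFP.recodeOut fun _ => rfl)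
    (fun q => ?_) (bad := badWord) ?_
  · obtain ⟨n, C⟩ := q
    change MvPolynomial.map (Int.castRingHom (ZMod p)) C.eval = 0 ↔
      MvPolynomial.map (Int.castRingHom (ZMod p)) (semPoly (pitInstanceEncoding.encode (pitCompress ⟨n, C⟩))) = 0
    rw [pitCompress, ← circuitWord_eq_encode, map_semPoly_circuitWord_compress_eq_zero_iff]
  · have h' : 0 ≤ Polynomial.X.eval (circuitWord 0 (ofConst (1 : ℤ))).length := Nat.zero_le _
    change ¬ MvPolynomial.map (Int.castRingHom (ZMod p)) (semPoly badWord) = 0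
    rw [badWord, semPoly, rdCircuit_circuitWord h', eval_rename_apply, eval_ofConst, MvPolynomial.rename_C,
      MvPolynomial.map_C, map_one, MvPolynomial.C_eq_zero]
    exact h1

end Reduction

section Prime

variable (p : ℕ) [hp : Fact p.Prime]

/-- The rejected word is not an identity modulo `p` either: its polynomial is `1`. [cite: KabanetsImpagliazzo2004, §2] -/
theorem map_semPoly_badWord_ne_zero : MvPolynomial.map (Int.castRingHom (ZMod p)) (semPoly badWord) ≠ 0 := by
  have h' : 0 ≤ Polynomial.X.eval (circuitWord 0 (ofConst (1 : ℤ))).length := Nat.zero_le _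
  rw [badWord, semPoly, rdCircuit_circuitWord h', eval_rename_apply, eval_ofConst, MvPolynomial.rename_C,
    MvPolynomial.map_C, map_one, Ne, MvPolynomial.C_eq_zero]
  exact one_ne_zero

/-- **`PITLanguageMod p ∈ coRP` for every prime `p`**: identity testing of integer arithmetic circuits
over the prime field `𝔽_p`, as a polynomial identity, is in `coRP` (Karp reduction to the zero set of the
code semantics mod `p`, `semPolyModZero_mem_coRP`, `mem_coRP_of_karpReducible`).
[cite: KabanetsImpagliazzo2004, §2.3 and Lemma 2.2] [cite: Schwartz1980, Cor. 1] [cite: AgrawalBiswas2003, §1] -/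
theorem PITLanguageMod_mem_coRP : PITLanguageMod p ∈ coRP :=
  mem_coRP_of_karpReducible
    (PITLanguageMod_karpReducible_semPolyModZero p (one_ne_zero)) (semPolyModZero_mem_coRP p)

/-- **`PITLanguageMod p ∈ BPP`** (`coRP ⊆ BPP`). [cite: AroraBarakCC2009, §7.3] -/
theorem PITLanguageMod_mem_BPP : PITLanguageMod p ∈ BPP :=
  ofLanguage_mem_PromiseBPP'_iff.1 (PromiseCoRP'_subset_PromiseBPP'
    (ofLanguage_mem_PromiseCoRP'_iff.2 (PITLanguageMod_mem_coRP p)))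

end Prime

/-! ### Every field: one interface for the verifier of an algebraic natural proof -/

section AnyField

variable (K : Type*) [Field K]

/-- **Vanishing over `K` is vanishing modulo the characteristic**: for an integer polynomial `P` and a
field `K`, `map (ℤ → K) P = 0 ↔ map (ℤ → ℤ/(ringChar K)) P = 0` (the map `ℤ/(ringChar K) → K` is
injective). [cite: AroraBarakCC2009, §A.4 (prime fields)] [cite: BlaserIkenmeyerJindalLysikov2018, §3 (proof of Thm. 4: constant-free circuits over `K`)] -/
theorem map_intCast_eq_zero_iff_ringChar {σ : Type*} (P : MvPolynomial σ ℤ) :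
    MvPolynomial.map (Int.castRingHom K) P = 0 ↔
      MvPolynomial.map (Int.castRingHom (ZMod (ringChar K))) P = 0 := by
  set q := ringChar K
  have hφ : (ZMod.castHom (dvd_refl q) K).comp (Int.castRingHom (ZMod q)) = Int.castRingHom K :=
    RingHom.ext_int _ _
  have hinj : Function.Injective (ZMod.castHom (dvd_refl q) K) := ZMod.castHom_injective K
  rw [← hφ, ← MvPolynomial.map_map]
  constructor
  · intro h
    exact MvPolynomial.map_injective _ hinj (by rw [h, map_zero])
  · intro h
    rw [h, map_zero]

/-- **For every field `K`, `PITLanguageMod (ringChar K) ∈ BPP`**: characteristic `0` is integer identity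
testing (`PITLanguageMod_zero`, `PITLanguage_mem_BPP` of `PITLanguageCoRP.lean`), prime characteristic is
`PITLanguageMod_mem_BPP`. Together with `map_intCast_eq_zero_iff_ringChar` and `mem_PITLanguageMod_iff`:
a verifier over ANY field `K` decides "the integer circuit `C` computes the zero polynomial over `K`" by
the single `BPP` query `⟨n, C⟩ ∈ PITLanguageMod (ringChar K)` — the identity-testing step of the `∃BPP`
machine of BIJL18 Thm. 4 in every characteristic.
[cite: BlaserIkenmeyerJindalLysikov2018, §3 (proof of Thm. 4)] [cite: KabanetsImpagliazzo2004, §2.3] -/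
theorem PITLanguageMod_ringChar_mem_BPP : PITLanguageMod (ringChar K) ∈ BPP := by
  rcases CharP.char_is_prime_or_zero K (ringChar K) with h | h
  · haveI : Fact (ringChar K).Prime := ⟨h⟩
    exact PITLanguageMod_mem_BPP _
  · rw [h, PITLanguageMod_zero]
    exact PITLanguage_mem_BPP

/-- The same interface spelled out on a code word: for a field `K` and an integer circuit `C`,
`⟨n, C⟩ ∈ PITLanguageMod (ringChar K) ↔ map (ℤ → K) C.eval = 0`.
[cite: BlaserIkenmeyerJindalLysikov2018, §3 (proof of Thm. 4)] -/
theorem mem_PITLanguageMod_ringChar_iff (n : ℕ) (C : ArithCircuit ℤ (Fin n)) :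
    boolPair (encodeNat n) (encodeArithCircuit n C) ∈ PITLanguageMod (ringChar K) ↔
      MvPolynomial.map (Int.castRingHom K) C.eval = 0 := by
  rw [mem_PITLanguageMod_iff, map_intCast_eq_zero_iff_ringChar]

end AnyField

end Literature.Computability.AlgebraicComplexity

end
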